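import Summits.QuantumFields.QCD.Theses.GapBuysCauchyRate
import Summits.QuantumFields.QCD.Theorems.GapBuysCauchyRateConvergentOSClosureStubSoftClosure
import Summits.QuantumFields.QCD.Theorems.GapBuysCauchyRateConvergentOSClosureStubAsymptoticTranslation
import Summits.QuantumFields.QCD.Theorems.GapBuysCauchyRateConvergentOSClosureStubSpeciesPackaging
import Summits.QuantumFields.QCD.Theorems.GapBuysCauchyRateConvergentOSClosureStubRpOfComparison
import Literature.MathematicalPhysics.QuantumFieldTheory.QCDAsymptoticScalingCouplingDivergence
import HarnessLib.Audit

/-!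
# Restatement evidence for crux `ConvergentOSClosure` (item stmt-QuantumFields-11525) — lead, 2026-08-17

Sorry-free.  Three theorems:

* `convergentOSClosure_of_inputs` — the crux AS TYPED follows from exactly four lattice-side statements, the open
  stubs T (`stub_tightness`: P2, k-uniform E0′ bound of the canonical lattice distributions), RP
  (`stub_approxPositiveForms`: P8, eventually approximately positive OS forms), CL (`stub_spatialClustering`: P9,
  k-uniform spatial clustering), CS (`stub_speciesCSClustering`: species Cauchy–Schwarz clustering at some rate),
  stated verbatim as hypotheses: the "closed modulo" certificate of line `birth` after waves 1–2 (everything else —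
  gap transfer without E1, packaging + witnesses, asymptotic translation invariance, the soft closure — is LANDED:
  p147450, p147393, p149834, p150754).
* `ConvergentOSClosureR` / `convergentOSClosureR_holds` — the REPAIRED crux: the hypotheses of `ConvergentOSClosure`
  plus, per `(reg, 𝒞, m)`, the four inputs (T) P2, (RP) P8, (CL) P9, (CS) `∃ Δ' > 0, HasSpeciesCSClustering Δ'`, with
  the conclusion of `ConvergentOSClosure` VERBATIM — PROVED (it is `stub_softClosure` + `stub_asymptoticTranslation` +
  `stub_speciesPackaging`).  This is the re-typing the lead recommends (route header, kill criterion (d), generalised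
  from E0′ to the four idle inputs); `LadderCauchyRate` must emit the same four clauses.
* `convergentOSClosure_imp_R` — the crux as typed implies R (R only adds hypotheses), so re-typing loses nothing.
* `ConvergentOSClosureR'` / `convergentOSClosureR'_holds` (wave 3) — the sharper re-typing for `N_f ≤ 16`: P8 is replaced by
  the primitive finite-volume input COMP (ε-uniform E0′-norm comparison periodic ↔ Θ-symmetrised thermal distributions),
  reflection positivity of the limit becoming a theorem (`stub_rpOfComparison`, p152669, on 9737's `stub_rpOfSymThermal`).

Why the four inputs are not consequences of the typed hypotheses (analyses attached to the item as evidence: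
`stub_tightness-analysis.md`, `stub_reflectionAxioms-analysis.md`, `stub_speciesDiagClustering-analysis.md`): pointwise
convergence on the span of off-diagonal real product tensors (dense, not barrelled) gives no k-uniform ⁰𝒮 bound (T);
the own-torus functional is the time-PERIODIC (−1)^F-twisted trace, reflection positivity is proved in the tree only for
the antiperiodic / Θ-symmetrised functionals and the comparison is unfiled (RP); `HasLatticeMassGap` bounds FIXED pairs
of local observables with per-pair constants and thresholds while smeared species truncated functions are normalised
sums over k-growing families of translated/product pairs — the Yang–Mills `GapToContinuum` defects D2/D3 verbatim (CL, CS).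
-/

noncomputable section

namespace Summit.QuantumFields.QCD.Cruxes.ConvergentOSClosure.Restatement

open scoped BigOperators Topology
open MeasureTheory Filter
open Literature.MathematicalPhysics.AQFT Literature.MathematicalPhysics.QuantumLattice
  Literature.MathematicalPhysics.QuantumFieldTheory
open Summit.QuantumFields.QCD.Cruxes.StableActionBridge.Sketch (qcdLatticeDist qcdLatticeDistSymAP)
open Summit.QuantumFields.QCD.Theses.GapBuysCauchyRate (ConvergentOSClosure)
open Summit.QuantumFields.QCD.Theorems.ConvergentOSClosure (stub_softClosure stub_asymptoticTranslation
  stub_speciesPackaging stub_rpOfComparison)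

/-- **Closed modulo T, RP, CL, CS.**  The crux as typed from the four open lattice-side inputs (their registered
signatures, verbatim) — everything else is landed. -/
theorem convergentOSClosure_of_inputs
    (hT : ∀ (Nf : ℕ) (reg : QCDRegularisation Nf) (𝒞 : CalibratedSpeciesFamily reg) (m : Fin Nf → ℝ), (∀ f, 0 < m f) →
    (𝒞.scheme m).HasAsymptoticScaling →
    (∀ fl : Fin Nf, ∀ᶠ k in Filter.atTop, -1 < (𝒞.scheme m).mq fl k) →
    (∃ Δ > 0, (𝒞.scheme m).HasLatticeMassGap Δ) →
    (∀ᶠ k in Filter.atTop, (𝒞.scheme m).twoPoint k QCDField.glue QCDField.glue (thetaTest 4 𝒞.f₀) 𝒞.f₀ = 1) →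
    (∀ f g : Fin Nf, f ≠ g →
    ∀ᶠ k in Filter.atTop, (𝒞.scheme m).twoPoint k (QCDField.pseudoRe f g) (QCDField.pseudoRe f g) (thetaTest 4 𝒞.f₀) 𝒞.f₀ = 1) →
    (∀ n : ℕ, n ≠ 0 →
    ∀ (σ : Fin n → QCDField Nf) (f : Fin n → SchwartzMap (EuclideanSpace ℝ (Fin 4)) ℝ) (F : SchwartzMap (Fin n → EuclideanSpace ℝ (Fin 4)) ℂ), IsTensorOf F (fun i => ofRealTest (f i)) → IsOffDiagonal F →
    ∃ c : ℂ, Filter.Tendsto (fun k : ℕ => qcdLatticeSchwinger (𝒞.scheme m) k n σ f) Filter.atTop (nhds c)) →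
    ∃ (s : ℕ) (α β : ℝ), 0 ≤ α ∧
      (∀ (n : ℕ) (σ : Fin n → QCDField Nf), ∀ᶠ k in Filter.atTop, ∀ F : SchwartzMap (Fin n → EuclideanSpace ℝ (Fin 4)) ℂ, IsOffDiagonal F → ‖qcdLatticeDist (𝒞.scheme m) k n σ F‖ ≤ α * (n.factorial : ℝ) ^ β * schwartzNorm (n * s) F))
    (hRP : ∀ (Nf : ℕ) (sch : QCDScheme Nf), sch.HasAsymptoticScaling →
    (∀ fl : Fin Nf, ∀ᶠ k in Filter.atTop, -1 < sch.mq fl k) →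
    (∃ Δ > 0, sch.HasLatticeMassGap Δ) →
    (∀ n : ℕ, n ≠ 0 →
    ∀ (σ : Fin n → QCDField Nf) (f : Fin n → SchwartzMap (EuclideanSpace ℝ (Fin 4)) ℝ) (F : SchwartzMap (Fin n → EuclideanSpace ℝ (Fin 4)) ℂ), IsTensorOf F (fun i => ofRealTest (f i)) → IsOffDiagonal F →
    ∃ c : ℂ, Filter.Tendsto (fun k : ℕ => qcdLatticeSchwinger sch k n σ f) Filter.atTop (nhds c)) →
    ∀ (s : ℕ) (α β : ℝ), 0 ≤ α →
    (∀ (n : ℕ) (σ : Fin n → QCDField Nf), ∀ᶠ k in Filter.atTop, ∀ F : SchwartzMap (Fin n → EuclideanSpace ℝ (Fin 4)) ℂ, IsOffDiagonal F → ‖qcdLatticeDist sch k n σ F‖ ≤ α * (n.factorial : ℝ) ^ β * schwartzNorm (n * s) F) →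
    (∀ (N : ℕ) (deg : Fin N → ℕ) (lab : (j : Fin N) → Fin (deg j) → QCDField Nf) (G : (j : Fin N) → SchwartzMap (Fin (deg j) → EuclideanSpace ℝ (Fin 4)) ℂ), (∀ j, IsTimeOrdered (G j)) →
    ∀ H : (i j : Fin N) → SchwartzMap (Fin (deg i + deg j) → EuclideanSpace ℝ (Fin 4)) ℂ, (∀ i j, IsAppendTensorOf (H i j) (osAdjoint (G i)) (G j)) →
    ∀ ε : ℝ, 0 < ε →
    ∀ᶠ l in Filter.atTop, -ε ≤ (∑ i, ∑ j, qcdLatticeDist sch l (deg i + deg j) (Fin.append (lab i ∘ Fin.rev) (lab j)) (H i j)).re ∧ |(∑ i, ∑ j, qcdLatticeDist sch l (deg i + deg j) (Fin.append (lab i ∘ Fin.rev) (lab j)) (H i j)).im| ≤ ε))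
    (hCL : ∀ (Nf : ℕ) (sch : QCDScheme Nf), sch.HasAsymptoticScaling →
    (∀ fl : Fin Nf, ∀ᶠ k in Filter.atTop, -1 < sch.mq fl k) →
    (∃ Δ > 0, sch.HasLatticeMassGap Δ) →
    (∀ n : ℕ, n ≠ 0 →
    ∀ (σ : Fin n → QCDField Nf) (f : Fin n → SchwartzMap (EuclideanSpace ℝ (Fin 4)) ℝ) (F : SchwartzMap (Fin n → EuclideanSpace ℝ (Fin 4)) ℂ), IsTensorOf F (fun i => ofRealTest (f i)) → IsOffDiagonal F →
    ∃ c : ℂ, Filter.Tendsto (fun k : ℕ => qcdLatticeSchwinger sch k n σ f) Filter.atTop (nhds c)) →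
    ∀ (s : ℕ) (α β : ℝ), 0 ≤ α →
    (∀ (n : ℕ) (σ : Fin n → QCDField Nf), ∀ᶠ k in Filter.atTop, ∀ F : SchwartzMap (Fin n → EuclideanSpace ℝ (Fin 4)) ℂ, IsOffDiagonal F → ‖qcdLatticeDist sch k n σ F‖ ≤ α * (n.factorial : ℝ) ^ β * schwartzNorm (n * s) F) →
    (∀ (n n' : ℕ) (σ : Fin n → QCDField Nf) (σ' : Fin n' → QCDField Nf) (F : SchwartzMap (Fin n → EuclideanSpace ℝ (Fin 4)) ℂ) (G : SchwartzMap (Fin n' → EuclideanSpace ℝ (Fin 4)) ℂ), IsTimeOrdered F → IsTimeOrdered G →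
    ∀ a : EuclideanSpace ℝ (Fin 4), a 0 = 0 → a ≠ 0 →
    ∀ ε : ℝ, 0 < ε →
    ∃ t₀ : ℝ, ∀ t : ℝ, t₀ ≤ t →
    ∀ H : SchwartzMap (Fin (n + n') → EuclideanSpace ℝ (Fin 4)) ℂ, IsAppendTensorOf H (osAdjoint F) (translateMulti (t • a) G) →
    ∀ᶠ k in Filter.atTop, ‖qcdLatticeDist sch k (n + n') (Fin.append (σ ∘ Fin.rev) σ') H - qcdLatticeDist sch k n (σ ∘ Fin.rev) (osAdjoint F) * qcdLatticeDist sch k n' σ' G‖ ≤ ε))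
    (hCS : ∀ (Nf : ℕ) (sch : QCDScheme Nf) (Δ : ℝ), 0 < Δ → sch.HasAsymptoticScaling →
    (∀ fl : Fin Nf, ∀ᶠ k in Filter.atTop, -1 < sch.mq fl k) → sch.HasLatticeMassGap Δ →
    (∀ n : ℕ, n ≠ 0 →
    ∀ (σ : Fin n → QCDField Nf) (f : Fin n → SchwartzMap (EuclideanSpace ℝ (Fin 4)) ℝ) (F : SchwartzMap (Fin n → EuclideanSpace ℝ (Fin 4)) ℂ), IsTensorOf F (fun i => ofRealTest (f i)) → IsOffDiagonal F →
    ∃ c : ℂ, Filter.Tendsto (fun k : ℕ => qcdLatticeSchwinger sch k n σ f) Filter.atTop (nhds c)) →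
    ∀ (s : ℕ) (α β : ℝ), 0 ≤ α →
    (∀ (n : ℕ) (σ : Fin n → QCDField Nf), ∀ᶠ k in Filter.atTop, ∀ F : SchwartzMap (Fin n → EuclideanSpace ℝ (Fin 4)) ℂ, IsOffDiagonal F → ‖qcdLatticeDist sch k n σ F‖ ≤ α * (n.factorial : ℝ) ^ β * schwartzNorm (n * s) F) →
    ∃ Δ' > 0, sch.HasSpeciesCSClustering Δ') :
    ConvergentOSClosure := by
  intro Nf reg 𝒞 m hm hAS hbr hgap h2g h2q h3g hconv
  obtain ⟨s, α, β, hα, hb⟩ := hT Nf reg 𝒞 m hm hAS hbr hgap h2g h2q hconv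
  have htr := stub_asymptoticTranslation Nf reg 𝒞 m hm hAS hbr hgap h2g h2q hconv s α β hα hb
  have hrp := hRP Nf (𝒞.scheme m) hAS hbr hgap hconv s α β hα hb
  have hcl := hCL Nf (𝒞.scheme m) hAS hbr hgap hconv s α β hα hb
  obtain ⟨Δ, hΔ, hgapΔ⟩ := hgap
  obtain ⟨Δ', hΔ', hCS'⟩ := hCS Nf (𝒞.scheme m) Δ hΔ hAS hbr hgapΔ hconv s α β hα hb
  obtain ⟨S, h0, h0', hE0', hE1t, hE2, hE3, hE4, htensor, hgap₀⟩ :=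
    stub_softClosure Nf (𝒞.scheme m) hconv s α β hα hb htr hrp hcl Δ Δ' hΔ hΔ' hgapΔ hCS'
  exact ⟨S, h0, h0', hE0', hE1t, hE2, hE3, hE4, htensor, hgap₀, fun hRot =>
    stub_speciesPackaging Nf reg 𝒞 m h2g h2q h3g S ⟨⟨h0, h0', ⟨hE1t, hRot⟩, hE2, hE3, hE4⟩, hE0'⟩ htensor⟩

/-- **The repaired crux R** (recommended re-typing of stmt-QuantumFields-11525): the hypotheses of
`ConvergentOSClosure`, then per `(reg, 𝒞, m)` the four lattice-side inputs — (T) the k-uniform E0′ bound on `⁰𝒮` of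
the canonical lattice distributions `qcdLatticeDist (𝒞.scheme m)`, (RP) eventually approximately positive OS forms,
(CL) k-uniform spatial clustering, (CS) species Cauchy–Schwarz clustering at some positive rate — and the conclusion of
`ConvergentOSClosure` verbatim. -/
def ConvergentOSClosureR : Prop :=
  ∀ (Nf : ℕ) (reg : QCDRegularisation Nf) (𝒞 : CalibratedSpeciesFamily reg) (m : Fin Nf → ℝ), (∀ f, 0 < m f) →
    (𝒞.scheme m).HasAsymptoticScaling →
    (∀ fl : Fin Nf, ∀ᶠ k in Filter.atTop, -1 < (𝒞.scheme m).mq fl k) →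
    (∃ Δ > 0, (𝒞.scheme m).HasLatticeMassGap Δ) →
    (∀ᶠ k in Filter.atTop, (𝒞.scheme m).twoPoint k QCDField.glue QCDField.glue (thetaTest 4 𝒞.f₀) 𝒞.f₀ = 1) →
    (∀ f g : Fin Nf, f ≠ g →
    ∀ᶠ k in Filter.atTop, (𝒞.scheme m).twoPoint k (QCDField.pseudoRe f g) (QCDField.pseudoRe f g) (thetaTest 4 𝒞.f₀) 𝒞.f₀ = 1) →
    (∃ f g h : SchwartzMap (EuclideanSpace ℝ (Fin 4)) ℝ, tsupport (f : EuclideanSpace ℝ (Fin 4) → ℝ) ⊆ {x | x 0 < 0} ∧ tsupport (g : EuclideanSpace ℝ (Fin 4) → ℝ) ⊆ {x | 0 < x 0 ∧ x 0 < 1} ∧ tsupport (h : EuclideanSpace ℝ (Fin 4) → ℝ) ⊆ {x | 1 < x 0} ∧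
      ∃ ε > (0 : ℝ), ∀ᶠ k in Filter.atTop, ε ≤ ‖qcdLatticeSchwinger (𝒞.scheme m) k 3 ![QCDField.glue, QCDField.glue, QCDField.glue] ![f, g, h] - qcdLatticeSchwinger (𝒞.scheme m) k 1 ![QCDField.glue] ![f] * qcdLatticeSchwinger (𝒞.scheme m) k 2 ![QCDField.glue, QCDField.glue] ![g, h] - qcdLatticeSchwinger (𝒞.scheme m) k 1 ![QCDField.glue] ![g] * qcdLatticeSchwinger (𝒞.scheme m) k 2 ![QCDField.glue, QCDField.glue] ![f, h] - qcdLatticeSchwinger (𝒞.scheme m) k 1 ![QCDField.glue] ![h] * qcdLatticeSchwinger (𝒞.scheme m) k 2 ![QCDField.glue, QCDField.glue] ![f, g] + 2 * (qcdLatticeSchwinger (𝒞.scheme m) k 1 ![QCDField.glue] ![f] * qcdLatticeSchwinger (𝒞.scheme m) k 1 ![QCDField.glue] ![g] * qcdLatticeSchwinger (𝒞.scheme m) k 1 ![QCDField.glue] ![h])‖) →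
    (∀ n : ℕ, n ≠ 0 →
    ∀ (σ : Fin n → QCDField Nf) (f : Fin n → SchwartzMap (EuclideanSpace ℝ (Fin 4)) ℝ) (F : SchwartzMap (Fin n → EuclideanSpace ℝ (Fin 4)) ℂ), IsTensorOf F (fun i => ofRealTest (f i)) → IsOffDiagonal F →
    ∃ c : ℂ, Filter.Tendsto (fun k : ℕ => qcdLatticeSchwinger (𝒞.scheme m) k n σ f) Filter.atTop (nhds c)) →
    (∃ (s : ℕ) (α β : ℝ), 0 ≤ α ∧
      (∀ (n : ℕ) (σ : Fin n → QCDField Nf), ∀ᶠ k in Filter.atTop, ∀ F : SchwartzMap (Fin n → EuclideanSpace ℝ (Fin 4)) ℂ, IsOffDiagonal F → ‖qcdLatticeDist (𝒞.scheme m) k n σ F‖ ≤ α * (n.factorial : ℝ) ^ β * schwartzNorm (n * s) F)) →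
    (∀ (N : ℕ) (deg : Fin N → ℕ) (lab : (j : Fin N) → Fin (deg j) → QCDField Nf) (G : (j : Fin N) → SchwartzMap (Fin (deg j) → EuclideanSpace ℝ (Fin 4)) ℂ), (∀ j, IsTimeOrdered (G j)) →
    ∀ H : (i j : Fin N) → SchwartzMap (Fin (deg i + deg j) → EuclideanSpace ℝ (Fin 4)) ℂ, (∀ i j, IsAppendTensorOf (H i j) (osAdjoint (G i)) (G j)) →
    ∀ ε : ℝ, 0 < ε →
    ∀ᶠ l in Filter.atTop, -ε ≤ (∑ i, ∑ j, qcdLatticeDist (𝒞.scheme m) l (deg i + deg j) (Fin.append (lab i ∘ Fin.rev) (lab j)) (H i j)).re ∧ |(∑ i, ∑ j, qcdLatticeDist (𝒞.scheme m) l (deg i + deg j) (Fin.append (lab i ∘ Fin.rev) (lab j)) (H i j)).im| ≤ ε) →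
    (∀ (n n' : ℕ) (σ : Fin n → QCDField Nf) (σ' : Fin n' → QCDField Nf) (F : SchwartzMap (Fin n → EuclideanSpace ℝ (Fin 4)) ℂ) (G : SchwartzMap (Fin n' → EuclideanSpace ℝ (Fin 4)) ℂ), IsTimeOrdered F → IsTimeOrdered G →
    ∀ a : EuclideanSpace ℝ (Fin 4), a 0 = 0 → a ≠ 0 →
    ∀ ε : ℝ, 0 < ε →
    ∃ t₀ : ℝ, ∀ t : ℝ, t₀ ≤ t →
    ∀ H : SchwartzMap (Fin (n + n') → EuclideanSpace ℝ (Fin 4)) ℂ, IsAppendTensorOf H (osAdjoint F) (translateMulti (t • a) G) →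
    ∀ᶠ k in Filter.atTop, ‖qcdLatticeDist (𝒞.scheme m) k (n + n') (Fin.append (σ ∘ Fin.rev) σ') H - qcdLatticeDist (𝒞.scheme m) k n (σ ∘ Fin.rev) (osAdjoint F) * qcdLatticeDist (𝒞.scheme m) k n' σ' G‖ ≤ ε) →
    (∃ Δ' > 0, (𝒞.scheme m).HasSpeciesCSClustering Δ') →
    ∃ S : LabelledSchwingerFamily (QCDField Nf) (EuclideanSpace ℝ (Fin 4)), S.IsNormalized ∧
      S.IsHermitian ∧
      S.HasLinearGrowth ∧
      (∀ (n : ℕ) (σ : Fin n → QCDField Nf) (a : EuclideanSpace ℝ (Fin 4)) (F : SchwartzMap (Fin n → EuclideanSpace ℝ (Fin 4)) ℂ), IsOffDiagonal F → S n σ (translateMulti a F) = S n σ F) ∧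
      S.IsReflectionPositive ∧
      S.IsSymmetric ∧
      S.HasClusterProperty ∧
      (∀ n : ℕ, n ≠ 0 →
    ∀ (σ : Fin n → QCDField Nf) (f : Fin n → SchwartzMap (EuclideanSpace ℝ (Fin 4)) ℝ) (F : SchwartzMap (Fin n → EuclideanSpace ℝ (Fin 4)) ℂ), IsTensorOf F (fun i => ofRealTest (f i)) → IsOffDiagonal F → Filter.Tendsto (fun k : ℕ => qcdLatticeSchwinger (𝒞.scheme m) k n σ f) Filter.atTop (nhds (S n σ F))) ∧
      (∃ Δ : ℝ, 0 < Δ ∧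
      S.HasMassGap Δ ∧
      (𝒞.scheme m).HasLatticeMassGap Δ) ∧
      ((∀ (n : ℕ) (σ : Fin n → QCDField Nf) (Rot : EuclideanSpace ℝ (Fin 4) ≃ₗᵢ[ℝ] EuclideanSpace ℝ (Fin 4)), LinearMap.det (Rot.toLinearEquiv : EuclideanSpace ℝ (Fin 4) →ₗ[ℝ] EuclideanSpace ℝ (Fin 4)) = 1 →
    ∀ F : SchwartzMap (Fin n → EuclideanSpace ℝ (Fin 4)) ℂ, IsOffDiagonal F → S n σ (linActMulti Rot F) = S n σ F) →
    ∃ T : OSData (QCDField Nf) 4, T.schwinger = S ∧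
      T.IsNontrivial QCDField.glue ∧
      T.IsNonGaussian QCDField.glue ∧ ∀ f g : Fin Nf, f ≠ g → T.IsNontrivial (QCDField.pseudoRe f g))

/-- **R is a theorem** (the landed `stub_softClosure`, `stub_asymptoticTranslation`, `stub_speciesPackaging`). -/
theorem convergentOSClosureR_holds : ConvergentOSClosureR := by
  intro Nf reg 𝒞 m hm hAS hbr hgap h2g h2q h3g hconv hT hrp hcl hCS
  obtain ⟨s, α, β, hα, hb⟩ := hT
  have htr := stub_asymptoticTranslation Nf reg 𝒞 m hm hAS hbr hgap h2g h2q hconv s α β hα hb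
  obtain ⟨Δ, hΔ, hgapΔ⟩ := hgap
  obtain ⟨Δ', hΔ', hCS'⟩ := hCS
  obtain ⟨S, h0, h0', hE0', hE1t, hE2, hE3, hE4, htensor, hgap₀⟩ :=
    stub_softClosure Nf (𝒞.scheme m) hconv s α β hα hb htr hrp hcl Δ Δ' hΔ hΔ' hgapΔ hCS'
  exact ⟨S, h0, h0', hE0', hE1t, hE2, hE3, hE4, htensor, hgap₀, fun hRot =>
    stub_speciesPackaging Nf reg 𝒞 m h2g h2q h3g S ⟨⟨h0, h0', ⟨hE1t, hRot⟩, hE2, hE3, hE4⟩, hE0'⟩ htensor⟩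

/-- Re-typing loses nothing: the crux as typed implies R. -/
theorem convergentOSClosure_imp_R : ConvergentOSClosure → ConvergentOSClosureR :=
  fun h Nf reg 𝒞 m hm hAS hbr hgap h2g h2q h3g hconv _ _ _ _ =>
    h Nf reg 𝒞 m hm hAS hbr hgap h2g h2q h3g hconv

/-- **The sharper repaired crux R′** (wave 3; recommended if the planner restricts to the physical flavour numbers):
for `N_f ≤ 16`, the hypotheses of `ConvergentOSClosure` plus (T+COMP) ONE norm index `s` with the k-uniform E0′ bound of
`qcdLatticeDist (𝒞.scheme m)` AND the ε-uniform E0′-norm comparison with the thermal Θ-symmetrised distributions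
`qcdLatticeDistSymAP` (the primitive finite-volume input; reflection positivity of the limit is then a THEOREM through
9737's landed `stub_rpOfSymThermal` and this crux's `stub_rpOfComparison`), (CL) P9, (CS) species CS clustering — with the
conclusion of `ConvergentOSClosure` verbatim. -/
def ConvergentOSClosureR' : Prop :=
  ∀ (Nf : ℕ) (reg : QCDRegularisation Nf) (𝒞 : CalibratedSpeciesFamily reg) (m : Fin Nf → ℝ), Nf ≤ 16 →
    (∀ f, 0 < m f) →
    (𝒞.scheme m).HasAsymptoticScaling →
    (∀ fl : Fin Nf, ∀ᶠ k in Filter.atTop, -1 < (𝒞.scheme m).mq fl k) →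
    (∃ Δ > 0, (𝒞.scheme m).HasLatticeMassGap Δ) →
    (∀ᶠ k in Filter.atTop, (𝒞.scheme m).twoPoint k QCDField.glue QCDField.glue (thetaTest 4 𝒞.f₀) 𝒞.f₀ = 1) →
    (∀ f g : Fin Nf, f ≠ g →
    ∀ᶠ k in Filter.atTop, (𝒞.scheme m).twoPoint k (QCDField.pseudoRe f g) (QCDField.pseudoRe f g) (thetaTest 4 𝒞.f₀) 𝒞.f₀ = 1) →
    (∃ f g h : SchwartzMap (EuclideanSpace ℝ (Fin 4)) ℝ, tsupport (f : EuclideanSpace ℝ (Fin 4) → ℝ) ⊆ {x | x 0 < 0} ∧ tsupport (g : EuclideanSpace ℝ (Fin 4) → ℝ) ⊆ {x | 0 < x 0 ∧ x 0 < 1} ∧ tsupport (h : EuclideanSpace ℝ (Fin 4) → ℝ) ⊆ {x | 1 < x 0} ∧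
      ∃ ε > (0 : ℝ), ∀ᶠ k in Filter.atTop, ε ≤ ‖qcdLatticeSchwinger (𝒞.scheme m) k 3 ![QCDField.glue, QCDField.glue, QCDField.glue] ![f, g, h] - qcdLatticeSchwinger (𝒞.scheme m) k 1 ![QCDField.glue] ![f] * qcdLatticeSchwinger (𝒞.scheme m) k 2 ![QCDField.glue, QCDField.glue] ![g, h] - qcdLatticeSchwinger (𝒞.scheme m) k 1 ![QCDField.glue] ![g] * qcdLatticeSchwinger (𝒞.scheme m) k 2 ![QCDField.glue, QCDField.glue] ![f, h] - qcdLatticeSchwinger (𝒞.scheme m) k 1 ![QCDField.glue] ![h] * qcdLatticeSchwinger (𝒞.scheme m) k 2 ![QCDField.glue, QCDField.glue] ![f, g] + 2 * (qcdLatticeSchwinger (𝒞.scheme m) k 1 ![QCDField.glue] ![f] * qcdLatticeSchwinger (𝒞.scheme m) k 1 ![QCDField.glue] ![g] * qcdLatticeSchwinger (𝒞.scheme m) k 1 ![QCDField.glue] ![h])‖) →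
    (∀ n : ℕ, n ≠ 0 →
    ∀ (σ : Fin n → QCDField Nf) (f : Fin n → SchwartzMap (EuclideanSpace ℝ (Fin 4)) ℝ) (F : SchwartzMap (Fin n → EuclideanSpace ℝ (Fin 4)) ℂ), IsTensorOf F (fun i => ofRealTest (f i)) → IsOffDiagonal F →
    ∃ c : ℂ, Filter.Tendsto (fun k : ℕ => qcdLatticeSchwinger (𝒞.scheme m) k n σ f) Filter.atTop (nhds c)) →
    (∃ (s : ℕ) (α β : ℝ), 0 ≤ α ∧
      (∀ (n : ℕ) (σ : Fin n → QCDField Nf), ∀ᶠ k in Filter.atTop, ∀ F : SchwartzMap (Fin n → EuclideanSpace ℝ (Fin 4)) ℂ, IsOffDiagonal F → ‖qcdLatticeDist (𝒞.scheme m) k n σ F‖ ≤ α * (n.factorial : ℝ) ^ β * schwartzNorm (n * s) F) ∧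
      (∀ ε : ℝ, 0 < ε →
    ∀ (n : ℕ) (σ : Fin n → QCDField Nf), ∀ᶠ k in Filter.atTop, ∀ F : SchwartzMap (Fin n → EuclideanSpace ℝ (Fin 4)) ℂ, IsOffDiagonal F → ‖qcdLatticeDistSymAP (𝒞.scheme m) k n σ F - qcdLatticeDist (𝒞.scheme m) k n σ F‖ ≤ ε * schwartzNorm (n * s) F)) →
    (∀ (n n' : ℕ) (σ : Fin n → QCDField Nf) (σ' : Fin n' → QCDField Nf) (F : SchwartzMap (Fin n → EuclideanSpace ℝ (Fin 4)) ℂ) (G : SchwartzMap (Fin n' → EuclideanSpace ℝ (Fin 4)) ℂ), IsTimeOrdered F → IsTimeOrdered G →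
    ∀ a : EuclideanSpace ℝ (Fin 4), a 0 = 0 → a ≠ 0 →
    ∀ ε : ℝ, 0 < ε →
    ∃ t₀ : ℝ, ∀ t : ℝ, t₀ ≤ t →
    ∀ H : SchwartzMap (Fin (n + n') → EuclideanSpace ℝ (Fin 4)) ℂ, IsAppendTensorOf H (osAdjoint F) (translateMulti (t • a) G) →
    ∀ᶠ k in Filter.atTop, ‖qcdLatticeDist (𝒞.scheme m) k (n + n') (Fin.append (σ ∘ Fin.rev) σ') H - qcdLatticeDist (𝒞.scheme m) k n (σ ∘ Fin.rev) (osAdjoint F) * qcdLatticeDist (𝒞.scheme m) k n' σ' G‖ ≤ ε) →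
    (∃ Δ' > 0, (𝒞.scheme m).HasSpeciesCSClustering Δ') →
    ∃ S : LabelledSchwingerFamily (QCDField Nf) (EuclideanSpace ℝ (Fin 4)), S.IsNormalized ∧
      S.IsHermitian ∧
      S.HasLinearGrowth ∧
      (∀ (n : ℕ) (σ : Fin n → QCDField Nf) (a : EuclideanSpace ℝ (Fin 4)) (F : SchwartzMap (Fin n → EuclideanSpace ℝ (Fin 4)) ℂ), IsOffDiagonal F → S n σ (translateMulti a F) = S n σ F) ∧
      S.IsReflectionPositive ∧
      S.IsSymmetric ∧
      S.HasClusterProperty ∧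
      (∀ n : ℕ, n ≠ 0 →
    ∀ (σ : Fin n → QCDField Nf) (f : Fin n → SchwartzMap (EuclideanSpace ℝ (Fin 4)) ℝ) (F : SchwartzMap (Fin n → EuclideanSpace ℝ (Fin 4)) ℂ), IsTensorOf F (fun i => ofRealTest (f i)) → IsOffDiagonal F → Filter.Tendsto (fun k : ℕ => qcdLatticeSchwinger (𝒞.scheme m) k n σ f) Filter.atTop (nhds (S n σ F))) ∧
      (∃ Δ : ℝ, 0 < Δ ∧
      S.HasMassGap Δ ∧
      (𝒞.scheme m).HasLatticeMassGap Δ) ∧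
      ((∀ (n : ℕ) (σ : Fin n → QCDField Nf) (Rot : EuclideanSpace ℝ (Fin 4) ≃ₗᵢ[ℝ] EuclideanSpace ℝ (Fin 4)), LinearMap.det (Rot.toLinearEquiv : EuclideanSpace ℝ (Fin 4) →ₗ[ℝ] EuclideanSpace ℝ (Fin 4)) = 1 →
    ∀ F : SchwartzMap (Fin n → EuclideanSpace ℝ (Fin 4)) ℂ, IsOffDiagonal F → S n σ (linActMulti Rot F) = S n σ F) →
    ∃ T : OSData (QCDField Nf) 4, T.schwinger = S ∧
      T.IsNontrivial QCDField.glue ∧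
      T.IsNonGaussian QCDField.glue ∧ ∀ f g : Fin Nf, f ≠ g → T.IsNontrivial (QCDField.pseudoRe f g))

/-- **R′ is a theorem** (landed `stub_rpOfComparison` p152669 + `stub_softClosure` + `stub_asymptoticTranslation` +
`stub_speciesPackaging`; `0 ≤ β_k` eventually from asymptotic scaling at `N_f ≤ 16`). -/
theorem convergentOSClosureR'_holds : ConvergentOSClosureR' := by
  intro Nf reg 𝒞 m hNf hm hAS hbr hgap h2g h2q h3g hconv hTC hcl hCS
  obtain ⟨s, α, β, hα, hb, hcomp⟩ := hTC
  have htr := stub_asymptoticTranslation Nf reg 𝒞 m hm hAS hbr hgap h2g h2q hconv s α β hα hb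
  have hrp := stub_rpOfComparison Nf (𝒞.scheme m)
    (QCDScheme.eventually_le_beta_of_hasAsymptoticScaling hNf (𝒞.scheme m) hAS 0) hbr s α β hα hb hcomp
  obtain ⟨Δ, hΔ, hgapΔ⟩ := hgap
  obtain ⟨Δ', hΔ', hCS'⟩ := hCS
  obtain ⟨S, h0, h0', hE0', hE1t, hE2, hE3, hE4, htensor, hgap₀⟩ :=
    stub_softClosure Nf (𝒞.scheme m) hconv s α β hα hb htr hrp hcl Δ Δ' hΔ hΔ' hgapΔ hCS'
  exact ⟨S, h0, h0', hE0', hE1t, hE2, hE3, hE4, htensor, hgap₀, fun hRot =>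
    stub_speciesPackaging Nf reg 𝒞 m h2g h2q h3g S ⟨⟨h0, h0', ⟨hE1t, hRot⟩, hE2, hE3, hE4⟩, hE0'⟩ htensor⟩

end Summit.QuantumFields.QCD.Cruxes.ConvergentOSClosure.Restatement

end
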